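import Summits.ValiantsHypothesis.ValiantsHypothesis.Theorems.LacunarySymmetroidMatrixDescartesCensusTwoRowElbowFive

/-!
# `MatrixDescartes` census — W4 boundary layer, kernel kit: THE GENERIC TWO-ROW-BOX LEAF

HONEST FRAMING.  Object-search cell `pub-symmetroid`, item `DoorA26 = PosRootLawAt 2 6 19` (stmt-ValiantsHypothesis-19979, OPEN,
typed, never asserted).  LIBRARY file (engine-1 g25, offer O4, desk ruling R1945): elementary lemmas about a fewnomial with TWO ROWS,
`P = Σ_{j≤m} A_j X^{a+d_j} − Σ_{j≤m} B_j X^{b+d_j}` (`B₁ > 0`, the other `B_j ≥ 0`; `m = 2, 3, 4`).  This is the shape of a hull-edge form of a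
HYPOTHETICAL Descartes-sharp `(2,6)` pencil after the two-row template of TWOROW-E1G19 §2 / HYBRID27-E2G27 §1 (rows `i₁, i₂` of one factor
against columns `J`, every other exponent killed by Euler twists, collision weights `λ` absorbed in `A_j, B_j`): `a = d_{i₁}`, `b = d_{i₂}`.
CORE (`countP_posRoots_twoRow₂/₃/₄_le_one`): by QUOTIENT ROLLE with multiplicity (`countP_posRoots_le_wronskian_add_one`, divisor
`g = Σ B_j X^{b+d_j}`, zero-free on `(0,∞)`) `#Z₊^{mult}(P) ≤ #Z₊^{mult}(W) + 1` with `W = g·P′ − P·g′`, and EULER's identity gives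
`x·W(x) = x^{a+b}·Φ(x^{d₁},…,x^{d_m})`, `Φ(w) = Σ_{j,k} A_jB_k((a+d_j) − (b+d_k)) w_jw_k` — so if the WRONSKIAN FORM `Φ` is negative on the
open orthant (hypothesis `hneg`, to be fed by ANY certificate), `W < 0` on `(0,∞)` and `#Z₊^{mult}(P) ≤ 1`.  In HYBRID27's letters
`Φ = (|a_{i₁}||a_{i₂}|/…)·Σ q̃_jk(ν̃) W_jW_k`: this is exactly the located «(Q) test».
CERTIFICATE (`twoRow₂/₃_form_neg_of_sdd`, SCALED DIAGONAL DOMINANCE on a ν-box): with `κ > 0` and `lo_j B_j ≤ κA_j ≤ hi_j B_j`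
(`ν_j = κA_j/B_j ∈ [lo_j, hi_j]` — the leaf's ν̃-box, `κ = |a_{i₂}/a_{i₁}|` free), numbers `T_jk ≥ 0` dominating the symmetrised cross
coefficient at the four corners of the `(j,k)` face, and weights `ρ_jk > 0`, `ρ_jk ρ_kj = 1`, the `m` strict inequalities
`Σ_{k≠j} T_jk ρ_jk < (b − a)·lo_j` give `Φ < 0` on the orthant (termwise bounds + weighted AM–GM).  Located datum (engine-1 g25,
tools/engine1/g25/boxleaf/sddtest.py): of the 165 two-row-box leaves in engine-2 g27's HYBRID27 trees of record, 109 are (Q)-leaves and the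
SDD certificate closes 100 of them as they stand (94/101 with m = 2, 6/8 with m = 3); the other (Q)-leaves need a sub-box split or a
PSD+NN corner certificate, the 56 (V)-leaves need the Descartes variant — both feed the same `hneg`-shaped core and are not in this file.
Every numeric side goal of an instance is `norm_num` on small rationals; big leaf constants are closed by the LOG TABLE (`…CensusLogPrimesTable`).
Nothing here bounds `ζ_sym(2,6)`, decides `DoorA26`, or bears on `MatrixDescartes` (stmt-ValiantsHypothesis-18050) / `VP ≠ VNP`.

[folklore] Quotient Rolle with multiplicity + Euler's operator + weighted AM–GM; no single source.
-/

-- `Summit.ValiantsHypothesis.ValiantsHypothesis.…` repeats a component by the D-0017 layout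
-- (single-conjunct summit), which the `dupNamespace` linter flags; the name is mandated.
set_option linter.dupNamespace false

namespace Summit.ValiantsHypothesis.ValiantsHypothesis.Theorems.LacunarySymmetroidMatrixDescartes.Census

open Polynomial Finset
open scoped BigOperators Polynomial

/-! ### Euler's operator on a monomial -/

/-- `X · (c·Xⁿ)′ = (c·n)·Xⁿ` (also for `n = 0`). [folklore] -/
theorem X_mul_derivative_C_mul_X_pow (c : ℝ) (n : ℕ) :
    (X : ℝ[X]) * derivative (C c * X ^ n) = C (c * (n : ℝ)) * X ^ n := by
  rw [derivative_C_mul_X_pow]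
  rcases n with _ | k
  · simp
  · rw [Nat.add_sub_cancel, pow_succ]
    ring

/-! ### Core: a negative Wronskian form leaves at most one positive root -/

/-- **Two-row box leaf, core, `m = 2` columns.**  If `B₁ > 0`, the other `B_j ≥ 0`, and the Wronskian form
`Φ(w) = Σ_{j,k} A_jB_k((a+d_j) − (b+d_k))·w_jw_k` is negative on the open orthant, then
`#Z₊^{mult}(Σ_j A_j X^{a+d_j} − Σ_j B_j X^{b+d_j}) ≤ 1` (quotient Rolle for the divisor `Σ_j B_j X^{b+d_j}` + Euler). [folklore] -/
theorem countP_posRoots_twoRow₂_le_one (A₁ A₂ B₁ B₂ : ℝ) (a b d₁ d₂ : ℕ)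
    (hB₁ : 0 < B₁) (hB₂ : 0 ≤ B₂)
    (hneg : ∀ w₁ w₂ : ℝ, 0 < w₁ → 0 < w₂ →
      A₁ * B₁ * ((a : ℝ) + d₁ - ((b : ℝ) + d₁)) * (w₁ * w₁) + A₁ * B₂ * ((a : ℝ) + d₁ - ((b : ℝ) + d₂)) * (w₁ * w₂) + A₂ * B₁ * ((a : ℝ) + d₂ - ((b : ℝ) + d₁)) * (w₂ * w₁) + A₂ * B₂ * ((a : ℝ) + d₂ - ((b : ℝ) + d₂)) * (w₂ * w₂) < 0) :
    (C A₁ * X ^ (a + d₁) + C A₂ * X ^ (a + d₂) - (C B₁ * X ^ (b + d₁) + C B₂ * X ^ (b + d₂)) : ℝ[X]).roots.countP (fun x => 0 < x) ≤ 1 := by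
  classical
  set P : ℝ[X] := C A₁ * X ^ (a + d₁) + C A₂ * X ^ (a + d₂) - (C B₁ * X ^ (b + d₁) + C B₂ * X ^ (b + d₂)) with hP_def
  set g : ℝ[X] := (C B₁ * X ^ (b + d₁) + C B₂ * X ^ (b + d₂) : ℝ[X]) with hg_def
  set W : ℝ[X] := g * derivative P - P * derivative g with hW_def
  have hXP : (X : ℝ[X]) * derivative P = C (A₁ * ((a + d₁ : ℕ) : ℝ)) * X ^ (a + d₁) + C (A₂ * ((a + d₂ : ℕ) : ℝ)) * X ^ (a + d₂) - (C (B₁ * ((b + d₁ : ℕ) : ℝ)) * X ^ (b + d₁) + C (B₂ * ((b + d₂ : ℕ) : ℝ)) * X ^ (b + d₂)) := by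
    simp only [hP_def, hg_def, derivative_add, derivative_sub, mul_add, mul_sub, X_mul_derivative_C_mul_X_pow]
  have hXg : (X : ℝ[X]) * derivative g = C (B₁ * ((b + d₁ : ℕ) : ℝ)) * X ^ (b + d₁) + C (B₂ * ((b + d₂ : ℕ) : ℝ)) * X ^ (b + d₂) := by
    simp only [hg_def, derivative_add, mul_add, X_mul_derivative_C_mul_X_pow]
  have hev : ∀ x : ℝ, x * W.eval x = x ^ a * x ^ b * (A₁ * B₁ * ((a : ℝ) + d₁ - ((b : ℝ) + d₁)) * (x ^ d₁ * x ^ d₁) + A₁ * B₂ * ((a : ℝ) + d₁ - ((b : ℝ) + d₂)) * (x ^ d₁ * x ^ d₂) + A₂ * B₁ * ((a : ℝ) + d₂ - ((b : ℝ) + d₁)) * (x ^ d₂ * x ^ d₁) + A₂ * B₂ * ((a : ℝ) + d₂ - ((b : ℝ) + d₂)) * (x ^ d₂ * x ^ d₂)) := by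
    intro x
    have h1 : x * W.eval x = ((X : ℝ[X]) * W).eval x := by rw [eval_mul, eval_X]
    have h2 : (X : ℝ[X]) * W = g * (X * derivative P) - P * (X * derivative g) := by rw [hW_def]; ring
    rw [h1, h2, hXP, hXg, hP_def, hg_def]
    simp only [eval_add, eval_sub, eval_mul, eval_C, eval_pow, eval_X]
    push_cast
    ring
  have hWneg : ∀ x : ℝ, 0 < x → W.eval x < 0 := by
    intro x hx
    have hform := hneg (x ^ d₁) (x ^ d₂) (pow_pos hx _) (pow_pos hx _)
    have hxab : 0 < x ^ a * x ^ b := by positivity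
    have hlt : x * W.eval x < 0 := by rw [hev x]; exact mul_neg_of_pos_of_neg hxab hform
    by_contra hcon
    have : 0 ≤ x * W.eval x := mul_nonneg hx.le (not_lt.mp hcon)
    linarith
  have hWne : W ≠ 0 := by
    intro h0
    have := hWneg 1 one_pos
    rw [h0, eval_zero] at this
    exact lt_irrefl _ this
  have hgpos : ∀ x : ℝ, 0 < x → g.eval x ≠ 0 := by
    intro x hx
    have hx1 : 0 < B₁ * x ^ (b + d₁) := mul_pos hB₁ (pow_pos hx _)
    have hx2 : 0 ≤ B₂ * x ^ (b + d₂) := mul_nonneg hB₂ (pow_pos hx _).le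
    have : 0 < g.eval x := by
      rw [hg_def]
      simp only [eval_add, eval_mul, eval_C, eval_pow, eval_X]
      linarith
    exact this.ne'
  have hWroots : W.roots.countP (fun x => 0 < x) = 0 := by
    rw [Multiset.countP_eq_zero]
    intro x hx hx0
    rw [mem_roots hWne, IsRoot.def] at hx
    have := hWneg x hx0
    rw [hx] at this
    exact lt_irrefl _ this
  have main := countP_posRoots_le_wronskian_add_one P g W hW_def hWne hgpos
  rw [hWroots] at main
  simpa using main

/-- **Two-row box leaf, core, `m = 3` columns.**  If `B₁ > 0`, the other `B_j ≥ 0`, and the Wronskian form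
`Φ(w) = Σ_{j,k} A_jB_k((a+d_j) − (b+d_k))·w_jw_k` is negative on the open orthant, then
`#Z₊^{mult}(Σ_j A_j X^{a+d_j} − Σ_j B_j X^{b+d_j}) ≤ 1` (quotient Rolle for the divisor `Σ_j B_j X^{b+d_j}` + Euler). [folklore] -/
theorem countP_posRoots_twoRow₃_le_one (A₁ A₂ A₃ B₁ B₂ B₃ : ℝ) (a b d₁ d₂ d₃ : ℕ)
    (hB₁ : 0 < B₁) (hB₂ : 0 ≤ B₂) (hB₃ : 0 ≤ B₃)
    (hneg : ∀ w₁ w₂ w₃ : ℝ, 0 < w₁ → 0 < w₂ → 0 < w₃ →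
      A₁ * B₁ * ((a : ℝ) + d₁ - ((b : ℝ) + d₁)) * (w₁ * w₁) + A₁ * B₂ * ((a : ℝ) + d₁ - ((b : ℝ) + d₂)) * (w₁ * w₂) + A₁ * B₃ * ((a : ℝ) + d₁ - ((b : ℝ) + d₃)) * (w₁ * w₃) + A₂ * B₁ * ((a : ℝ) + d₂ - ((b : ℝ) + d₁)) * (w₂ * w₁) + A₂ * B₂ * ((a : ℝ) + d₂ - ((b : ℝ) + d₂)) * (w₂ * w₂) + A₂ * B₃ * ((a : ℝ) + d₂ - ((b : ℝ) + d₃)) * (w₂ * w₃) + A₃ * B₁ * ((a : ℝ) + d₃ - ((b : ℝ) + d₁)) * (w₃ * w₁) + A₃ * B₂ * ((a : ℝ) + d₃ - ((b : ℝ) + d₂)) * (w₃ * w₂) + A₃ * B₃ * ((a : ℝ) + d₃ - ((b : ℝ) + d₃)) * (w₃ * w₃) < 0) :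
    (C A₁ * X ^ (a + d₁) + C A₂ * X ^ (a + d₂) + C A₃ * X ^ (a + d₃) - (C B₁ * X ^ (b + d₁) + C B₂ * X ^ (b + d₂) + C B₃ * X ^ (b + d₃)) : ℝ[X]).roots.countP (fun x => 0 < x) ≤ 1 := by
  classical
  set P : ℝ[X] := C A₁ * X ^ (a + d₁) + C A₂ * X ^ (a + d₂) + C A₃ * X ^ (a + d₃) - (C B₁ * X ^ (b + d₁) + C B₂ * X ^ (b + d₂) + C B₃ * X ^ (b + d₃)) with hP_def
  set g : ℝ[X] := (C B₁ * X ^ (b + d₁) + C B₂ * X ^ (b + d₂) + C B₃ * X ^ (b + d₃) : ℝ[X]) with hg_def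
  set W : ℝ[X] := g * derivative P - P * derivative g with hW_def
  have hXP : (X : ℝ[X]) * derivative P = C (A₁ * ((a + d₁ : ℕ) : ℝ)) * X ^ (a + d₁) + C (A₂ * ((a + d₂ : ℕ) : ℝ)) * X ^ (a + d₂) + C (A₃ * ((a + d₃ : ℕ) : ℝ)) * X ^ (a + d₃) - (C (B₁ * ((b + d₁ : ℕ) : ℝ)) * X ^ (b + d₁) + C (B₂ * ((b + d₂ : ℕ) : ℝ)) * X ^ (b + d₂) + C (B₃ * ((b + d₃ : ℕ) : ℝ)) * X ^ (b + d₃)) := by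
    simp only [hP_def, hg_def, derivative_add, derivative_sub, mul_add, mul_sub, X_mul_derivative_C_mul_X_pow]
  have hXg : (X : ℝ[X]) * derivative g = C (B₁ * ((b + d₁ : ℕ) : ℝ)) * X ^ (b + d₁) + C (B₂ * ((b + d₂ : ℕ) : ℝ)) * X ^ (b + d₂) + C (B₃ * ((b + d₃ : ℕ) : ℝ)) * X ^ (b + d₃) := by
    simp only [hg_def, derivative_add, mul_add, X_mul_derivative_C_mul_X_pow]
  have hev : ∀ x : ℝ, x * W.eval x = x ^ a * x ^ b * (A₁ * B₁ * ((a : ℝ) + d₁ - ((b : ℝ) + d₁)) * (x ^ d₁ * x ^ d₁) + A₁ * B₂ * ((a : ℝ) + d₁ - ((b : ℝ) + d₂)) * (x ^ d₁ * x ^ d₂) + A₁ * B₃ * ((a : ℝ) + d₁ - ((b : ℝ) + d₃)) * (x ^ d₁ * x ^ d₃) + A₂ * B₁ * ((a : ℝ) + d₂ - ((b : ℝ) + d₁)) * (x ^ d₂ * x ^ d₁) + A₂ * B₂ * ((a : ℝ) + d₂ - ((b : ℝ) + d₂)) * (x ^ d₂ * x ^ d₂) + A₂ * B₃ * ((a :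 ℝ) + d₂ - ((b : ℝ) + d₃)) * (x ^ d₂ * x ^ d₃) + A₃ * B₁ * ((a : ℝ) + d₃ - ((b : ℝ) + d₁)) * (x ^ d₃ * x ^ d₁) + A₃ * B₂ * ((a : ℝ) + d₃ - ((b : ℝ) + d₂)) * (x ^ d₃ * x ^ d₂) + A₃ * B₃ * ((a : ℝ) + d₃ - ((b : ℝ) + d₃)) * (x ^ d₃ * x ^ d₃)) := by
    intro x
    have h1 : x * W.eval x = ((X : ℝ[X]) * W).eval x := by rw [eval_mul, eval_X]
    have h2 : (X : ℝ[X]) * W = g * (X * derivative P) - P * (X * derivative g) := by rw [hW_def]; ring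
    rw [h1, h2, hXP, hXg, hP_def, hg_def]
    simp only [eval_add, eval_sub, eval_mul, eval_C, eval_pow, eval_X]
    push_cast
    ring
  have hWneg : ∀ x : ℝ, 0 < x → W.eval x < 0 := by
    intro x hx
    have hform := hneg (x ^ d₁) (x ^ d₂) (x ^ d₃) (pow_pos hx _) (pow_pos hx _) (pow_pos hx _)
    have hxab : 0 < x ^ a * x ^ b := by positivity
    have hlt : x * W.eval x < 0 := by rw [hev x]; exact mul_neg_of_pos_of_neg hxab hform
    by_contra hcon
    have : 0 ≤ x * W.eval x := mul_nonneg hx.le (not_lt.mp hcon)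
    linarith
  have hWne : W ≠ 0 := by
    intro h0
    have := hWneg 1 one_pos
    rw [h0, eval_zero] at this
    exact lt_irrefl _ this
  have hgpos : ∀ x : ℝ, 0 < x → g.eval x ≠ 0 := by
    intro x hx
    have hx1 : 0 < B₁ * x ^ (b + d₁) := mul_pos hB₁ (pow_pos hx _)
    have hx2 : 0 ≤ B₂ * x ^ (b + d₂) := mul_nonneg hB₂ (pow_pos hx _).le
    have hx3 : 0 ≤ B₃ * x ^ (b + d₃) := mul_nonneg hB₃ (pow_pos hx _).le
    have : 0 < g.eval x := by
      rw [hg_def]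
      simp only [eval_add, eval_mul, eval_C, eval_pow, eval_X]
      linarith
    exact this.ne'
  have hWroots : W.roots.countP (fun x => 0 < x) = 0 := by
    rw [Multiset.countP_eq_zero]
    intro x hx hx0
    rw [mem_roots hWne, IsRoot.def] at hx
    have := hWneg x hx0
    rw [hx] at this
    exact lt_irrefl _ this
  have main := countP_posRoots_le_wronskian_add_one P g W hW_def hWne hgpos
  rw [hWroots] at main
  simpa using main

/-- **Two-row box leaf, core, `m = 4` columns.**  If `B₁ > 0`, the other `B_j ≥ 0`, and the Wronskian form
`Φ(w) = Σ_{j,k} A_jB_k((a+d_j) − (b+d_k))·w_jw_k` is negative on the open orthant, then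
`#Z₊^{mult}(Σ_j A_j X^{a+d_j} − Σ_j B_j X^{b+d_j}) ≤ 1` (quotient Rolle for the divisor `Σ_j B_j X^{b+d_j}` + Euler). [folklore] -/
theorem countP_posRoots_twoRow₄_le_one (A₁ A₂ A₃ A₄ B₁ B₂ B₃ B₄ : ℝ) (a b d₁ d₂ d₃ d₄ : ℕ)
    (hB₁ : 0 < B₁) (hB₂ : 0 ≤ B₂) (hB₃ : 0 ≤ B₃) (hB₄ : 0 ≤ B₄)
    (hneg : ∀ w₁ w₂ w₃ w₄ : ℝ, 0 < w₁ → 0 < w₂ → 0 < w₃ → 0 < w₄ →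
      A₁ * B₁ * ((a : ℝ) + d₁ - ((b : ℝ) + d₁)) * (w₁ * w₁) + A₁ * B₂ * ((a : ℝ) + d₁ - ((b : ℝ) + d₂)) * (w₁ * w₂) + A₁ * B₃ * ((a : ℝ) + d₁ - ((b : ℝ) + d₃)) * (w₁ * w₃) + A₁ * B₄ * ((a : ℝ) + d₁ - ((b : ℝ) + d₄)) * (w₁ * w₄) + A₂ * B₁ * ((a : ℝ) + d₂ - ((b : ℝ) + d₁)) * (w₂ * w₁) + A₂ * B₂ * ((a : ℝ) + d₂ - ((b : ℝ) + d₂)) * (w₂ * w₂) + A₂ * B₃ * ((a : ℝ) + d₂ - ((b : ℝ) + d₃)) * (w₂ * w₃) + A₂ * B₄ * ((a : ℝ) + d₂ - ((b : ℝ) + d₄)) * (w₂ * w₄) + A₃ * B₁ * ((a : ℝ) + d₃ - ((b : ℝ) + d₁)) * (w₃ * w₁) + A₃ * B₂ * ((a : ℝ) + d₃ - ((b : ℝ) + d₂)) * (w₃ * w₂) + A₃ * B₃ * ((a : ℝ) + d₃ - ((b : ℝ) + d₃)) * (w₃ * w₃) + A₃ * B₄ * ((a : ℝ) + d₃ - ((b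 : ℝ) + d₄)) * (w₃ * w₄) + A₄ * B₁ * ((a : ℝ) + d₄ - ((b : ℝ) + d₁)) * (w₄ * w₁) + A₄ * B₂ * ((a : ℝ) + d₄ - ((b : ℝ) + d₂)) * (w₄ * w₂) + A₄ * B₃ * ((a : ℝ) + d₄ - ((b : ℝ) + d₃)) * (w₄ * w₃) + A₄ * B₄ * ((a : ℝ) + d₄ - ((b : ℝ) + d₄)) * (w₄ * w₄) < 0) :
    (C A₁ * X ^ (a + d₁) + C A₂ * X ^ (a + d₂) + C A₃ * X ^ (a + d₃) + C A₄ * X ^ (a + d₄) - (C B₁ * X ^ (b + d₁) + C B₂ * X ^ (b + d₂) + C B₃ * X ^ (b + d₃) + C B₄ * X ^ (b + d₄)) : ℝ[X]).roots.countP (fun x => 0 < x) ≤ 1 := by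
  classical
  set P : ℝ[X] := C A₁ * X ^ (a + d₁) + C A₂ * X ^ (a + d₂) + C A₃ * X ^ (a + d₃) + C A₄ * X ^ (a + d₄) - (C B₁ * X ^ (b + d₁) + C B₂ * X ^ (b + d₂) + C B₃ * X ^ (b + d₃) + C B₄ * X ^ (b + d₄)) with hP_def
  set g : ℝ[X] := (C B₁ * X ^ (b + d₁) + C B₂ * X ^ (b + d₂) + C B₃ * X ^ (b + d₃) + C B₄ * X ^ (b + d₄) : ℝ[X]) with hg_def
  set W : ℝ[X] := g * derivative P - P * derivative g with hW_def
  have hXP : (X : ℝ[X]) * derivative P = C (A₁ * ((a + d₁ : ℕ) : ℝ)) * X ^ (a + d₁) + C (A₂ * ((a + d₂ : ℕ) : ℝ)) * X ^ (a + d₂) + C (A₃ * ((a + d₃ : ℕ) : ℝ)) * X ^ (a + d₃) + C (A₄ * ((a + d₄ : ℕ) : ℝ)) * X ^ (a + d₄) - (C (B₁ * ((b + d₁ : ℕ) : ℝ)) * X ^ (b + d₁) + C (B₂ * ((b + d₂ : ℕ) : ℝ)) * X ^ (b + d₂) + C (B₃ * ((b + d₃ : ℕ) : ℝ)) * X ^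 (b + d₃) + C (B₄ * ((b + d₄ : ℕ) : ℝ)) * X ^ (b + d₄)) := by
    simp only [hP_def, hg_def, derivative_add, derivative_sub, mul_add, mul_sub, X_mul_derivative_C_mul_X_pow]
  have hXg : (X : ℝ[X]) * derivative g = C (B₁ * ((b + d₁ : ℕ) : ℝ)) * X ^ (b + d₁) + C (B₂ * ((b + d₂ : ℕ) : ℝ)) * X ^ (b + d₂) + C (B₃ * ((b + d₃ : ℕ) : ℝ)) * X ^ (b + d₃) + C (B₄ * ((b + d₄ : ℕ) : ℝ)) * X ^ (b + d₄) := by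
    simp only [hg_def, derivative_add, mul_add, X_mul_derivative_C_mul_X_pow]
  have hev : ∀ x : ℝ, x * W.eval x = x ^ a * x ^ b * (A₁ * B₁ * ((a : ℝ) + d₁ - ((b : ℝ) + d₁)) * (x ^ d₁ * x ^ d₁) + A₁ * B₂ * ((a : ℝ) + d₁ - ((b : ℝ) + d₂)) * (x ^ d₁ * x ^ d₂) + A₁ * B₃ * ((a : ℝ) + d₁ - ((b : ℝ) + d₃)) * (x ^ d₁ * x ^ d₃) + A₁ * B₄ * ((a : ℝ) + d₁ - ((b : ℝ) + d₄)) * (x ^ d₁ * x ^ d₄) + A₂ * B₁ * ((a : ℝ) + d₂ - ((b : ℝ) + d₁)) * (x ^ d₂ * x ^ d₁) + A₂ * B₂ * ((a : ℝ) + d₂ - ((b : ℝ) + d₂)) * (x ^ d₂ * x ^ d₂) + A₂ * B₃ * ((a : ℝ) + d₂ - ((b : ℝ) + d₃)) * (x ^ d₂ * x ^ d₃) + A₂ * B₄ * ((a : ℝ) + d₂ - ((b : ℝ) + d₄)) * (x ^ d₂ * x ^ d₄) + A₃ * B₁ * ((a : ℝ) + d₃ - ((b : ℝ) + d₁)) *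 (x ^ d₃ * x ^ d₁) + A₃ * B₂ * ((a : ℝ) + d₃ - ((b : ℝ) + d₂)) * (x ^ d₃ * x ^ d₂) + A₃ * B₃ * ((a : ℝ) + d₃ - ((b : ℝ) + d₃)) * (x ^ d₃ * x ^ d₃) + A₃ * B₄ * ((a : ℝ) + d₃ - ((b : ℝ) + d₄)) * (x ^ d₃ * x ^ d₄) + A₄ * B₁ * ((a : ℝ) + d₄ - ((b : ℝ) + d₁)) * (x ^ d₄ * x ^ d₁) + A₄ * B₂ * ((a : ℝ) + d₄ - ((b : ℝ) + d₂)) * (x ^ d₄ * x ^ d₂) + A₄ * B₃ * ((a : ℝ) + d₄ - ((b : ℝ) + d₃)) * (x ^ d₄ * x ^ d₃) + A₄ * B₄ * ((a : ℝ) + d₄ - ((b : ℝ) + d₄)) * (x ^ d₄ * x ^ d₄)) := by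
    intro x
    have h1 : x * W.eval x = ((X : ℝ[X]) * W).eval x := by rw [eval_mul, eval_X]
    have h2 : (X : ℝ[X]) * W = g * (X * derivative P) - P * (X * derivative g) := by rw [hW_def]; ring
    rw [h1, h2, hXP, hXg, hP_def, hg_def]
    simp only [eval_add, eval_sub, eval_mul, eval_C, eval_pow, eval_X]
    push_cast
    ring
  have hWneg : ∀ x : ℝ, 0 < x → W.eval x < 0 := by
    intro x hx
    have hform := hneg (x ^ d₁) (x ^ d₂) (x ^ d₃) (x ^ d₄) (pow_pos hx _) (pow_pos hx _) (pow_pos hx _) (pow_pos hx _)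
    have hxab : 0 < x ^ a * x ^ b := by positivity
    have hlt : x * W.eval x < 0 := by rw [hev x]; exact mul_neg_of_pos_of_neg hxab hform
    by_contra hcon
    have : 0 ≤ x * W.eval x := mul_nonneg hx.le (not_lt.mp hcon)
    linarith
  have hWne : W ≠ 0 := by
    intro h0
    have := hWneg 1 one_pos
    rw [h0, eval_zero] at this
    exact lt_irrefl _ this
  have hgpos : ∀ x : ℝ, 0 < x → g.eval x ≠ 0 := by
    intro x hx
    have hx1 : 0 < B₁ * x ^ (b + d₁) := mul_pos hB₁ (pow_pos hx _)
    have hx2 : 0 ≤ B₂ * x ^ (b + d₂) := mul_nonneg hB₂ (pow_pos hx _).le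
    have hx3 : 0 ≤ B₃ * x ^ (b + d₃) := mul_nonneg hB₃ (pow_pos hx _).le
    have hx4 : 0 ≤ B₄ * x ^ (b + d₄) := mul_nonneg hB₄ (pow_pos hx _).le
    have : 0 < g.eval x := by
      rw [hg_def]
      simp only [eval_add, eval_mul, eval_C, eval_pow, eval_X]
      linarith
    exact this.ne'
  have hWroots : W.roots.countP (fun x => 0 < x) = 0 := by
    rw [Multiset.countP_eq_zero]
    intro x hx hx0
    rw [mem_roots hWne, IsRoot.def] at hx
    have := hWneg x hx0
    rw [hx] at this
    exact lt_irrefl _ this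
  have main := countP_posRoots_le_wronskian_add_one P g W hW_def hWne hgpos
  rw [hWroots] at main
  simpa using main

end Summit.ValiantsHypothesis.ValiantsHypothesis.Theorems.LacunarySymmetroidMatrixDescartes.Census
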